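import Literature.MathematicalPhysics.QuantumLattice.HubbardNNNHoppingTorusSectorCertificate
import Literature.MathematicalPhysics.QuantumLattice.HubbardSpinChargeCertificate
import Literature.MathematicalPhysics.QuantumLattice.OrbitStateLocalCertificate
import HarnessLib

/-!
# Rung R3 — SECTOR-mode (finite-torus) observable certificates with every constraint class of a
# `certsdp/1(.1)` §9 `total_plus` file (part 1 of 2: the generic edge and the certificate data type;
# part 2 = `PairCorrSectorRows`, the `pair_dd` LIST consumer of engines docket F-pairdd-1)

HONEST FRAMING (page 1): ladder R1–R4 with certified numbers; no claim on H/H₀. This pair of files proves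
SOUNDNESS EDGES and types ONE certificate-data structure; no certificate of the kind they consume
exists (no `pair_dd` instance has been run by anyone; result line (iii) of record, verbatim: no R3
instance has been run; no dichotomy is certified at any size; there are no brackets to overlap).

FILE SPLIT: §1–§2 below live in THIS module; §3–§4 (pair rows, ceiling, energy glue, the `4 × 4` chain) in
`Summits.HubbardSuperconductivity.HubbardLadder.PairCorrSectorRows`, which imports it. One docstring, two modules
(the 400-line cap); the section list is kept whole in both so either file reads on its own.

WHY THIS FILE. The engines' `pair_dd` objective kind (FORMAT-certsdp1 §9 addendum, rev 2, LIST form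
`Σᵢ λᵢ V_{rᵢ}`; readers A and B wired against this cell's sixteen test vectors) is admitted ONLY in the
SETTING "finite torus, `hypotheses.mode = sector`, `objective = total_plus`" (its P-1). A §9 certificate is
the exact identity, in the CAR algebra of the torus,
  `O − E·1 − κ (u·1 − H) = S + Σ_r λ_r O_r + (charged residual monomials) + (neutral residual monomials)`,
`S` a Gram sum of squares, `O_r` ∈ {commutators `[H, m]` of the PHYSICAL `H`, two-sided sector-ideal rows
`(N̂ − N) m`, `m (N̂ − N)`, `(S^z − M) m`, `m (S^z − M)`}, `κ ≥ 0` the multiplier of the one `energy_upper`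
inequality `ω(H) ≤ u`, and `E_cert = E − Σ_{neutral α ≠ 1} |p_α|` (FORMAT §3 sector CLASS and BOUND, §7, §9).
The tree's consumers of this shape are (a) the ENERGY objective (`TorusSectorCertTT'`,
`minEnergyOn_szSector_ge_of_sector_certificate`: every class, tracial sector ground state) and (b) the
Literature §9 correlator edge `re_dotProduct_ge_of_sector_certificate_ineq_of_eigenvector_of_energy_le`,
which is stated for the PURE graph Hamiltonian `hamiltonian G t U` (`t' = 0`) and the `N̂`-ideal only;
the cell's R2 rows `re_expect_sectorGS_ge_of_windowCertificate(_symm)` have no slots for charged words,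
anti-Hermitian parts or the `Σ |p_α|` residual of a ROUNDED certificate. The first instance the lead may
name, `pairrows-N14-min` (`4 × 4`, `U = 8`, `N = 14`, `t' = −1/4`), therefore had no consumer. This file:

* §1 `re_expect_ge_of_sectorObsCertificate` — GENERIC over a finite orbital lattice: ANY Hermitian `A`,
  any unit `ψ ∈ szSector N M` with `A ψ = E ψ`, `E ≤ u`, `0 ≤ κ`, and the identity above with every class
  (Gram, commutators with `A`, both sector ideals two-sided, charged ladder words, anti-Hermitian parts,
  neutral residual ladder words) ⇒ `c − Σ ‖aₖ‖ ≤ Re ⟨ψ, X ψ⟩`; `…_of_sectorGS` — the same for every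
  `IsGroundStateInSector A N M ψ` given `A.minEnergyOn (szSector N M) ≤ u`. NO symmetry-identification
  class: a vector state is not symmetric (FORMAT §9: the producer's group only AVERAGES multipliers; the
  identity is checked as written), so nothing is assumed about the objective's invariance.
* §2 `TorusSectorObsCertTT' L t t' U N M u X q` — the certificate DATA for the `t–t'` torus
  `hubbardTorusTT' L t t' U` (field layout of `Bounds.TorusSectorLowerRows.TorusSectorCertTT'` minus the
  identification family, plus `κ`, `hκ`), the energy hypothesis constant `u` and the objective `X` IN THE
  TYPE; edges `.re_expect_ge_of_eigenvector`, `.re_expect_ge` (every sector ground state).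
* §3 the `pair_dd` list objective `pairListObjective L lam r = Σᵢ λᵢ V_{rᵢ}`,
  `V_r = pairCorrSym L r = ½ (O_r + O_rᴴ)`, `O_r = pairCorrOp L r = Σ_x Δ_x† Δ_{x+r}` (R3-PAIRROWS-SPEC §2 =
  addendum P-2); `Re ⟨ψ, Σᵢ λᵢ V_{rᵢ} ψ⟩ = L² Σᵢ λᵢ P̄_d(L, rᵢ; ψ)`; two single-entry certificates (`λ = ±1`)
  ⇒ the R3 row `PairCorrWindowCert` with window `[q₊/L², −q₋/L²]` (`PairCorrWindowCert.ofSectorPairCerts`);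
  a list certificate representing a block `S` (`hrep`, as in `UpperBlockListCertTT'`) with `λᵢ = −wᵢ`
  ⇒ the finite-size ceiling `p_d(L; ψ) ≤ −q / (|S|² L²)` on every sector ground state (block Cauchy–Schwarz,
  `card_sq_mul_pairFieldDensity_le_sum_avgPairCorr`).
* §4 the energy-hypothesis glue: a typed UPPER claim `groundEnergy (hubbardRectTorusTT' L L t t' U) (2 nh) ≤ u`
  (the shape of the cell's T-UP / Slater / LUC leaves) ⇒ `minEnergyOn (szSector (2 nh) 0) ≤ u`
  (`groundEnergy_hubbardTorusTT'_eq_rect`, Lieb's `S^z = 0` representative); the `4 × 4`, `U = 8`, `N = 14`,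
  `t' = −1/4` chain end to end, and its calibration against the in-tree node `Bounds.slaterUpper_4x4_U8_N14_tpm1o4_uhf`.

Every hypothesis is a binder or a structure field; nothing about the Hubbard ground state is assumed; no
number is introduced. A concrete certificate enters the tree exactly as the energy rows do: a claim node
`Nonempty (TorusSectorObsCertTT' 4 1 (-1/4) 8 14 0 u (pairListObjective 4 lam r) q)` whose evidence is the
verifier-B-passed file, plus the typed upper claim discharging `u`.

## References
* J. Wang et al., *Certifying ground-state properties of many-body systems*, PRX 14 (2024) 031006,
  §3 eq. (obsopt) (energy-constrained relaxation of a finite cluster). [cite: WangEtAl2024, §3 eq. (obsopt)]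
* X. Han, *Quantum many-body bootstrap*, arXiv:2006.06002 (2020), §2 eq. (2)–(4) (charges, ideals,
  stationarity). [cite: Han2020Bootstrap, §2 eq. (2)–(4)]
* I. Kull, N. Schuch, B. Dive, M. Navascués, PRX 14 (2024) 021008, §5.3 (rounded certificates).
  [cite: KullEtAl2024, §5.3]
* M. Qin et al., PRX 10 (2020) 031016, §II eqs. (2)–(4) (the `d`-wave pair correlator). [cite: QinEtAl2020, §II eqs. (2)–(4)]
* E. H. Lieb, PRL 62 (1989) 1201, proof of Thm 1 (`S^z = 0` representatives). [cite: LiebPRL1989]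
* Cell documents: `run/shared/lean/pub/pub-mbboot/certs/FORMAT-certsdp1.md` §3, §7, §9;
  `run/shared/lean/engines/code/certsdp/docs/FORMAT-certsdp1-addendum-pairdd-draft.md` (rev 2) P-1–P-6;
  `pub-hubbard-r3/R3-PAIRROWS-SPEC.md` §2, §5, §10.
-/

noncomputable section

namespace Summit.HubbardSuperconductivity.HubbardLadder

open Matrix Finset Literature.MathematicalPhysics.QuantumLattice Literature.Probability.LatticeModels
-- The tree has two definitionally equal `vectorState`s (`QuantumLattice.CorrelationLightCone`,
-- `QuantumManyBody.StateRelaxation`); this file names the `StateRelaxation` one and its `_apply` lemma in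
-- full, so that it elaborates whichever of the two is in the import closure.
open Literature.MathematicalPhysics.QuantumManyBody.StateRelaxation
open scoped ComplexOrder

/-! ## §1 Generic: an all-classes sector-mode certificate read in a joint `(N, S^z)` energy eigenvector -/

section Generic

variable {Λ : Type*} [LinearOrder Λ] [Fintype Λ]

/-- **Sector-mode observable certificate, all constraint classes, eigenvector form.** Let `A` be
Hermitian on the Fock space of the orbital lattice `Orb Λ`, `ψ` a unit vector of the joint sector
`szSector N M` with `A ψ = E ψ`, `E ≤ u` and `0 ≤ κ`. An identity
`X − c·1 − κ (u·1 − A) = Σ Λᵢⱼ Oᵢᴴ Oⱼ + ((Σₖ (A Xₖ − Xₖ A) + Σᵢ (Zᵢ (N̂ − N) + (N̂ − N) Z'ᵢ)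
  + Σᵢ (Sᵢ (S^z − M) + (S^z − M) S'ᵢ)) + Σⱼ bⱼ • wⱼ) + (Σₘ dₘ • (Vₘᴴ − Vₘ) + Σₖ aₖ • vₖ)`
with `Λ ⪰ 0`, CHARGED ladder words `wⱼ`, real `dₘ` and ladder words `vₖ` gives
`c − Σₖ ‖aₖ‖ ≤ Re ⟨ψ, X ψ⟩`: in the vector state of `ψ` the Gram form is nonnegative, commutators with
`A` vanish (eigenvector), both two-sided ideals vanish, charged words vanish (joint `N̂, S^z`
eigenvector), anti-Hermitian parts have zero real part, each `vₖ` (a contraction) costs at most `‖aₖ‖`,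
and `κ ⟨ψ, (u·1 − A) ψ⟩ = κ (u − E) ≥ 0`. This is FORMAT-certsdp1 §3 (sector CLASS/BOUND) + §7 + §9 for an
arbitrary Hermitian `A` conserving nothing in particular (only `ψ`'s sector membership is used).
[cite: WangEtAl2024, §3 eq. (obsopt)] [cite: Han2020Bootstrap, §2 eq. (2)–(4)] [cite: KullEtAl2024, §5.3] -/
theorem re_expect_ge_of_sectorObsCertificate
    (A : Matrix (Finset (Orb Λ)) (Finset (Orb Λ)) ℂ) (hA : A.IsHermitian)
    {N : ℕ} {M : ℝ} {ψ : Fock (Orb Λ)}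
    (hψK : ψ ∈ (szSector N M : Submodule ℂ (Fock (Orb Λ)))) (hψ1 : star ψ ⬝ᵥ ψ = 1)
    {E : ℝ} (hAψ : A *ᵥ ψ = (E : ℂ) • ψ)
    (X : Matrix (Finset (Orb Λ)) (Finset (Orb Λ)) ℂ) {κ u : ℝ} (hκ : 0 ≤ κ) (hu : E ≤ u)
    {m : Type*} [Fintype m] [DecidableEq m] {Λm : Matrix m m ℂ} (hΛm : Λm.PosSemidef)
    (O : m → Matrix (Finset (Orb Λ)) (Finset (Orb Λ)) ℂ)
    {ι₁ : Type*} (s : Finset ι₁) (Xc : ι₁ → Matrix (Finset (Orb Λ)) (Finset (Orb Λ)) ℂ)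
    {ι₂ : Type*} (r : Finset ι₂) (Z Z' : ι₂ → Matrix (Finset (Orb Λ)) (Finset (Orb Λ)) ℂ)
    {ι₃ : Type*} (r' : Finset ι₃) (S S' : ι₃ → Matrix (Finset (Orb Λ)) (Finset (Orb Λ)) ℂ)
    {ι₄ : Type*} (uc : Finset ι₄) (b : ι₄ → ℂ) (cw : ι₄ → List (Orb Λ × Bool))
    (hcw : ∀ j ∈ uc, ladderCharge (cw j) ≠ 0 ∨ ladderSpinCharge (cw j) ≠ 0)
    {ι₅ : Type*} (ah : Finset ι₅) (dc : ι₅ → ℝ) (V : ι₅ → Matrix (Finset (Orb Λ)) (Finset (Orb Λ)) ℂ)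
    {ι₆ : Type*} (w : Finset ι₆) (a : ι₆ → ℂ) (word : ι₆ → List (Orb Λ × Bool)) {c : ℝ}
    (hcert : X - (c : ℂ) • (1 : Matrix (Finset (Orb Λ)) (Finset (Orb Λ)) ℂ) -
        (κ : ℂ) • ((u : ℂ) • (1 : Matrix (Finset (Orb Λ)) (Finset (Orb Λ)) ℂ) - A) =
      gramForm Λm O +
        ((∑ k ∈ s, (A * Xc k - Xc k * A) +
          ∑ i ∈ r, (Z i * (totalNumber - (N : ℂ) • 1) + (totalNumber - (N : ℂ) • 1) * Z' i) +
          ∑ i ∈ r', (S i * (HubbardWave0.spinZ - (M : ℂ) • 1) +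
            (HubbardWave0.spinZ - (M : ℂ) • 1) * S' i)) +
          ∑ j ∈ uc, b j • ladderWord (cw j)) +
        (∑ m' ∈ ah, ((dc m' : ℝ) : ℂ) • ((V m')ᴴ - V m') + ∑ k ∈ w, a k • ladderWord (word k))) :
    c - ∑ k ∈ w, ‖a k‖ ≤ (star ψ ⬝ᵥ X *ᵥ ψ).re := by
  obtain ⟨hNψ, hSψ⟩ := (mem_szSector_iff N M ψ).1 hψK
  set ω := Literature.MathematicalPhysics.QuantumManyBody.StateRelaxation.vectorState ψ with hω
  have hpos : ∀ x : Matrix (Finset (Orb Λ)) (Finset (Orb Λ)) ℂ, 0 ≤ ω (star x * x) :=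
    fun x => vectorState_nonneg ψ x
  have hone : ω 1 = 1 := by rw [hω, Literature.MathematicalPhysics.QuantumManyBody.StateRelaxation.vectorState_apply, one_mulVec, hψ1]
  -- the objective with the energy constraint folded in
  set X' := X - (κ : ℂ) • ((u : ℂ) • (1 : Matrix (Finset (Orb Λ)) (Finset (Orb Λ)) ℂ) - A) with hX'
  have hcert' : X' - (c : ℂ) • (1 : Matrix (Finset (Orb Λ)) (Finset (Orb Λ)) ℂ) =
      gramForm Λm O +
        ((∑ k ∈ s, (A * Xc k - Xc k * A) +
          ∑ i ∈ r, (Z i * (totalNumber - (N : ℂ) • 1) + (totalNumber - (N : ℂ) • 1) * Z' i) +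
          ∑ i ∈ r', (S i * (HubbardWave0.spinZ - (M : ℂ) • 1) +
            (HubbardWave0.spinZ - (M : ℂ) • 1) * S' i)) +
          ∑ j ∈ uc, b j • ladderWord (cw j)) +
        (∑ m' ∈ ah, ((dc m' : ℝ) : ℂ) • ((V m')ᴴ - V m') + ∑ k ∈ w, a k • ladderWord (word k)) := by
    rw [hX', sub_right_comm]
    exact hcert
  -- the two ideal generators annihilate `ψ` and are Hermitian
  have hZN : (totalNumber - (N : ℂ) • (1 : Matrix (Finset (Orb Λ)) (Finset (Orb Λ)) ℂ)) *ᵥ ψ = 0 := by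
    rw [sub_mulVec, totalNumber_mulVec_of_isNParticle hNψ, smul_mulVec, one_mulVec, sub_self]
  have hZN' : (totalNumber - (N : ℂ) • (1 : Matrix (Finset (Orb Λ)) (Finset (Orb Λ)) ℂ))ᴴ *ᵥ ψ = 0 := by
    rw [conjTranspose_sub, conjTranspose_smul, conjTranspose_one, totalNumber_isHermitian.eq,
      Complex.star_def, Complex.conj_natCast]
    exact hZN
  have hZS : (HubbardWave0.spinZ - (M : ℂ) • (1 : Matrix (Finset (Orb Λ)) (Finset (Orb Λ)) ℂ)) *ᵥ ψ
      = 0 := by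
    rw [sub_mulVec, hSψ, smul_mulVec, one_mulVec, sub_self]
  have hZS' : (HubbardWave0.spinZ - (M : ℂ) • (1 : Matrix (Finset (Orb Λ)) (Finset (Orb Λ)) ℂ))ᴴ *ᵥ ψ
      = 0 := by
    rw [conjTranspose_sub, conjTranspose_smul, conjTranspose_one, HubbardWave0.spinZ_isHermitian.eq,
      Complex.star_def, Complex.conj_ofReal]
    exact hZS
  have hnull : ω ((∑ k ∈ s, (A * Xc k - Xc k * A) +
      ∑ i ∈ r, (Z i * (totalNumber - (N : ℂ) • 1) + (totalNumber - (N : ℂ) • 1) * Z' i) +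
      ∑ i ∈ r', (S i * (HubbardWave0.spinZ - (M : ℂ) • 1) +
        (HubbardWave0.spinZ - (M : ℂ) • 1) * S' i)) +
      ∑ j ∈ uc, b j • ladderWord (cw j)) = 0 := by
    rw [map_add, map_add, map_add, map_sum, map_sum, map_sum, map_sum]
    have h1 : ∀ k ∈ s, ω (A * Xc k - Xc k * A) = 0 := fun k _ => vectorState_commutator hA hAψ _
    have h2 : ∀ i ∈ r,
        ω (Z i * (totalNumber - (N : ℂ) • 1) + (totalNumber - (N : ℂ) • 1) * Z' i) = 0 := fun i _ => by
      rw [map_add, hω, vectorState_mul_of_mulVec_eq_zero ψ (Z i) hZN,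
        vectorState_mul_of_conjTranspose_mulVec_eq_zero ψ (Z' i) hZN', add_zero]
    have h3 : ∀ i ∈ r',
        ω (S i * (HubbardWave0.spinZ - (M : ℂ) • 1) + (HubbardWave0.spinZ - (M : ℂ) • 1) * S' i) = 0 :=
      fun i _ => by
      rw [map_add, hω, vectorState_mul_of_mulVec_eq_zero ψ (S i) hZS,
        vectorState_mul_of_conjTranspose_mulVec_eq_zero ψ (S' i) hZS', add_zero]
    have h4 : ∀ j ∈ uc, ω (b j • ladderWord (cw j)) = 0 := fun j hj => by
      rw [map_smul, hω, Literature.MathematicalPhysics.QuantumManyBody.StateRelaxation.vectorState_apply, smul_eq_mul]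
      rcases hcw j hj with hq | hq
      · rw [star_dotProduct_ladderWord_mulVec_eq_zero hNψ (cw j) hq, mul_zero]
      · rw [star_dotProduct_ladderWord_mulVec_eq_zero_of_spinCharge hSψ (cw j) hq, mul_zero]
    rw [Finset.sum_eq_zero h1, Finset.sum_eq_zero h2, Finset.sum_eq_zero h3, Finset.sum_eq_zero h4]
    simp
  have hres : -(∑ k ∈ w, ‖a k‖) ≤
      (ω (∑ m' ∈ ah, ((dc m' : ℝ) : ℂ) • ((V m')ᴴ - V m') + ∑ k ∈ w, a k • ladderWord (word k))).re := by
    have hah : (ω (∑ m' ∈ ah, ((dc m' : ℝ) : ℂ) • ((V m')ᴴ - V m'))).re = 0 := by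
      rw [map_sum, Complex.re_sum]
      refine Finset.sum_eq_zero fun m' _ => ?_
      have hV : (ω ((V m')ᴴ - V m')).re = 0 := vectorState_re_conjTranspose_sub ψ (V m')
      rw [map_smul, smul_eq_mul, Complex.mul_re, Complex.ofReal_re, Complex.ofReal_im, zero_mul,
        sub_zero, hV, mul_zero]
    have hr : -(∑ k ∈ w, ‖a k‖) ≤ (ω (∑ k ∈ w, a k • ladderWord (word k))).re :=
      neg_sum_norm_le_re_map_sum w ω a (fun k => ladderWord (word k)) fun k _ => by
        have h := (isContraction_prod_ladder (word k)).neg_norm_mul_le (a k) ψ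
        rw [hψ1, Complex.one_re, mul_one] at h
        rw [hω, Literature.MathematicalPhysics.QuantumManyBody.StateRelaxation.vectorState_apply, ladderWord_eq_prod]
        exact h
    rw [map_add, Complex.add_re, hah, zero_add]
    exact hr
  have h := le_re_map_of_certificate_residual ω hpos hone hΛm O hnull hres hcert'
  -- evaluate the folded objective in the eigenvector `ψ`
  have hωA : ω A = (E : ℂ) := by
    rw [hω, Literature.MathematicalPhysics.QuantumManyBody.StateRelaxation.vectorState_apply, hAψ, dotProduct_smul, hψ1, smul_eq_mul,
      mul_one]
  have hωX' : ω X' = ω X - (κ : ℂ) * ((u : ℂ) - (E : ℂ)) := by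
    rw [hX', map_sub, map_smul, map_sub, map_smul, hone, hωA, smul_eq_mul, smul_eq_mul, mul_one]
  have hre : (ω X').re = (star ψ ⬝ᵥ X *ᵥ ψ).re - κ * (u - E) := by
    rw [hωX', Complex.sub_re, hω, Literature.MathematicalPhysics.QuantumManyBody.StateRelaxation.vectorState_apply]
    have e : (κ : ℂ) * ((u : ℂ) - (E : ℂ)) = ((κ * (u - E) : ℝ) : ℂ) := by push_cast; rfl
    rw [e, Complex.ofReal_re]
  rw [hre] at h
  have hslack : 0 ≤ κ * (u - E) := mul_nonneg hκ (sub_nonneg.2 hu)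
  linarith

/-- **Every sector ground state.** The certificate of `re_expect_ge_of_sectorObsCertificate` gives
`c − Σₖ ‖aₖ‖ ≤ Re ⟨ψ, X ψ⟩` for EVERY unit `IsGroundStateInSector A N M ψ`, provided the hypothesis
constant dominates the sector ground energy, `A.minEnergyOn (szSector N M) ≤ u` — the one external
input (a certified UPPER bound; §4). For a degenerate ground multiplet this covers every ground vector
of the joint sector, symmetric or not. [cite: WangEtAl2024, §3 eq. (obsopt)] -/
theorem re_expect_ge_of_sectorObsCertificate_of_sectorGS
    (A : Matrix (Finset (Orb Λ)) (Finset (Orb Λ)) ℂ) (hA : A.IsHermitian)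
    {N : ℕ} {M : ℝ} {ψ : Fock (Orb Λ)} (hψ1 : star ψ ⬝ᵥ ψ = 1) (hgs : IsGroundStateInSector A N M ψ)
    (X : Matrix (Finset (Orb Λ)) (Finset (Orb Λ)) ℂ) {κ u : ℝ} (hκ : 0 ≤ κ)
    (hu : A.minEnergyOn (szSector N M) ≤ u)
    {m : Type*} [Fintype m] [DecidableEq m] {Λm : Matrix m m ℂ} (hΛm : Λm.PosSemidef)
    (O : m → Matrix (Finset (Orb Λ)) (Finset (Orb Λ)) ℂ)
    {ι₁ : Type*} (s : Finset ι₁) (Xc : ι₁ → Matrix (Finset (Orb Λ)) (Finset (Orb Λ)) ℂ)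
    {ι₂ : Type*} (r : Finset ι₂) (Z Z' : ι₂ → Matrix (Finset (Orb Λ)) (Finset (Orb Λ)) ℂ)
    {ι₃ : Type*} (r' : Finset ι₃) (S S' : ι₃ → Matrix (Finset (Orb Λ)) (Finset (Orb Λ)) ℂ)
    {ι₄ : Type*} (uc : Finset ι₄) (b : ι₄ → ℂ) (cw : ι₄ → List (Orb Λ × Bool))
    (hcw : ∀ j ∈ uc, ladderCharge (cw j) ≠ 0 ∨ ladderSpinCharge (cw j) ≠ 0)
    {ι₅ : Type*} (ah : Finset ι₅) (dc : ι₅ → ℝ) (V : ι₅ → Matrix (Finset (Orb Λ)) (Finset (Orb Λ)) ℂ)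
    {ι₆ : Type*} (w : Finset ι₆) (a : ι₆ → ℂ) (word : ι₆ → List (Orb Λ × Bool)) {c : ℝ}
    (hcert : X - (c : ℂ) • (1 : Matrix (Finset (Orb Λ)) (Finset (Orb Λ)) ℂ) -
        (κ : ℂ) • ((u : ℂ) • (1 : Matrix (Finset (Orb Λ)) (Finset (Orb Λ)) ℂ) - A) =
      gramForm Λm O +
        ((∑ k ∈ s, (A * Xc k - Xc k * A) +
          ∑ i ∈ r, (Z i * (totalNumber - (N : ℂ) • 1) + (totalNumber - (N : ℂ) • 1) * Z' i) +
          ∑ i ∈ r', (S i * (HubbardWave0.spinZ - (M : ℂ) • 1) +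
            (HubbardWave0.spinZ - (M : ℂ) • 1) * S' i)) +
          ∑ j ∈ uc, b j • ladderWord (cw j)) +
        (∑ m' ∈ ah, ((dc m' : ℝ) : ℂ) • ((V m')ᴴ - V m') + ∑ k ∈ w, a k • ladderWord (word k))) :
    c - ∑ k ∈ w, ‖a k‖ ≤ (star ψ ⬝ᵥ X *ᵥ ψ).re :=
  re_expect_ge_of_sectorObsCertificate A hA hgs.1 hψ1 hgs.2.2 X hκ hu hΛm O s Xc r Z Z' r' S S' uc b
    cw hcw ah dc V w a word hcert

end Generic

/-! ## §2 The certificate data type for the `t–t'` torus and its edges -/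

section Torus

variable {L : ℕ} [NeZero L]

/-- (Local to this file, as in `Bounds.TorusSectorLowerRows` / `HubbardNNNHoppingTorusSectorCertificate`.)
Torus sites are compared through the linear order. [folklore] -/
local instance (priority := high) instDecidableEqFermionTorusPairSectorCert :
    DecidableEq (FermionTorus 2 L) :=
  LinearOrder.toDecidableEq

/-- **A sector-mode OBSERVABLE certificate for the `t–t'` torus `(ℤ/Lℤ)²`** in the joint sector
`(N, S^z = M)`, with energy-hypothesis constant `u`, objective `X` and value `q` (FORMAT-certsdp1 §3/§7/§9:
every multiplier class of a `sector`/`total_plus` file with `objective_h0_coeff = 0` and one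
`energy_upper` row; index types `Fin _`): Gram block `Λm ⪰ 0` on words `O`; `eom` commutators
`[H, Xc k]` of the PHYSICAL `H = hubbardTorusTT' L t t' U`; ideal families `Z (N̂ − N) + (N̂ − N) Z'` and
`S (S^z − M) + (S^z − M) S'`; charged ladder words `b • w`; anti-Hermitian parts `dc • (Vᴴ − V)`; neutral
residual words `a • v`; the inequality multiplier `κ ≥ 0`; the exact identity `hcert`; `hq : c − Σ ‖a k‖ = q`.
NO symmetry-identification family (a vector state is not symmetric; the producer's group only averages
multipliers). A term of this type IS a checked certificate; `u` is a HYPOTHESIS constant discharged only by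
a certified upper bound (`.re_expect_ge`, §4). HONEST FRAMING: ladder R1–R4 with certified numbers; no
claim on H/H₀. [cite: WangEtAl2024, §3 eq. (obsopt)] [cite: Han2020Bootstrap, §2 eq. (2)–(4)] -/
structure TorusSectorObsCertTT' (L : ℕ) [NeZero L] (t t' U : ℝ) (N : ℕ) (M : ℝ) (u : ℝ)
    (X : Matrix (Finset (Orb (FermionTorus 2 L))) (Finset (Orb (FermionTorus 2 L))) ℂ) (q : ℝ) where
  m : ℕ
  Λm : Matrix (Fin m) (Fin m) ℂ
  hΛm : Λm.PosSemidef
  O : Fin m → Matrix (Finset (Orb (FermionTorus 2 L))) (Finset (Orb (FermionTorus 2 L))) ℂ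
  ns : ℕ
  Xc : Fin ns → Matrix (Finset (Orb (FermionTorus 2 L))) (Finset (Orb (FermionTorus 2 L))) ℂ
  nr : ℕ
  Z : Fin nr → Matrix (Finset (Orb (FermionTorus 2 L))) (Finset (Orb (FermionTorus 2 L))) ℂ
  Z' : Fin nr → Matrix (Finset (Orb (FermionTorus 2 L))) (Finset (Orb (FermionTorus 2 L))) ℂ
  nr' : ℕ
  S : Fin nr' → Matrix (Finset (Orb (FermionTorus 2 L))) (Finset (Orb (FermionTorus 2 L))) ℂ
  S' : Fin nr' → Matrix (Finset (Orb (FermionTorus 2 L))) (Finset (Orb (FermionTorus 2 L))) ℂ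
  nu : ℕ
  b : Fin nu → ℂ
  cw : Fin nu → List (Orb (FermionTorus 2 L) × Bool)
  hcw : ∀ j, ladderCharge (cw j) ≠ 0 ∨ ladderSpinCharge (cw j) ≠ 0
  nah : ℕ
  dc : Fin nah → ℝ
  V : Fin nah → Matrix (Finset (Orb (FermionTorus 2 L))) (Finset (Orb (FermionTorus 2 L))) ℂ
  nw : ℕ
  a : Fin nw → ℂ
  word : Fin nw → List (Orb (FermionTorus 2 L) × Bool)
  c : ℝ
  κ : ℝ
  hκ : 0 ≤ κ
  hcert : X - (c : ℂ) • (1 : Matrix (Finset (Orb (FermionTorus 2 L))) (Finset (Orb (FermionTorus 2 L))) ℂ) -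
      (κ : ℂ) • ((u : ℂ) • (1 : Matrix (Finset (Orb (FermionTorus 2 L))) (Finset (Orb (FermionTorus 2 L))) ℂ) -
        hubbardTorusTT' L t t' U) =
    gramForm Λm O +
      ((∑ k, (hubbardTorusTT' L t t' U * Xc k - Xc k * hubbardTorusTT' L t t' U) +
        ∑ i, (Z i * (totalNumber - (N : ℂ) • 1) + (totalNumber - (N : ℂ) • 1) * Z' i) +
        ∑ i, (S i * (HubbardWave0.spinZ - (M : ℂ) • 1) + (HubbardWave0.spinZ - (M : ℂ) • 1) * S' i)) +
        ∑ j, b j • ladderWord (cw j)) +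
      (∑ m', ((dc m' : ℝ) : ℂ) • ((V m')ᴴ - V m') + ∑ k, a k • ladderWord (word k))
  hq : c - ∑ k, ‖a k‖ = q

namespace TorusSectorObsCertTT'

variable {t t' U : ℝ} {N : ℕ} {M u q : ℝ}
  {X : Matrix (Finset (Orb (FermionTorus 2 L))) (Finset (Orb (FermionTorus 2 L))) ℂ}

/-- **Kernel edge, eigenvector form**: for every unit `ψ ∈ szSector N M` with `H ψ = E ψ`, `E ≤ u`:
`q ≤ Re ⟨ψ, X ψ⟩` (FORMAT §9 MEANING: "for ANY `H`-eigenvector of the sector that is `S^z`-eigen").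
HONEST FRAMING: ladder R1–R4 with certified numbers; no claim on H/H₀. [cite: WangEtAl2024, §3 eq. (obsopt)] -/
theorem re_expect_ge_of_eigenvector (C : TorusSectorObsCertTT' L t t' U N M u X q)
    {ψ : Fock (Orb (FermionTorus 2 L))}
    (hψK : ψ ∈ (szSector N M : Submodule ℂ (Fock (Orb (FermionTorus 2 L))))) (hψ1 : star ψ ⬝ᵥ ψ = 1)
    {E : ℝ} (hHψ : hubbardTorusTT' L t t' U *ᵥ ψ = (E : ℂ) • ψ) (hEu : E ≤ u) :
    q ≤ (star ψ ⬝ᵥ X *ᵥ ψ).re := by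
  rw [← C.hq]
  exact re_expect_ge_of_sectorObsCertificate (hubbardTorusTT' L t t' U) (hubbardTorusTT'_isHermitian L t t' U)
    hψK hψ1 hHψ X C.hκ hEu C.hΛm C.O univ C.Xc univ C.Z C.Z' univ C.S C.S' univ C.b C.cw
    (fun j _ => C.hcw j) univ C.dc C.V univ C.a C.word C.hcert

/-- **Kernel edge, every sector ground state**: given the energy hypothesis
`minEnergyOn H (szSector N M) ≤ u`, `q ≤ Re ⟨ψ, X ψ⟩` for EVERY unit ground state `ψ` of `H` in the joint
sector `(N, S^z = M)`. HONEST FRAMING: ladder R1–R4 with certified numbers; no claim on H/H₀.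
[cite: WangEtAl2024, §3 eq. (obsopt)] -/
theorem re_expect_ge (C : TorusSectorObsCertTT' L t t' U N M u X q)
    (hE : (hubbardTorusTT' L t t' U).minEnergyOn (szSector N M) ≤ u)
    (ψ : Fock (Orb (FermionTorus 2 L))) (hψ1 : star ψ ⬝ᵥ ψ = 1)
    (hgs : IsGroundStateInSector (hubbardTorusTT' L t t' U) N M ψ) :
    q ≤ (star ψ ⬝ᵥ X *ᵥ ψ).re :=
  C.re_expect_ge_of_eigenvector hgs.1 hψ1 hgs.2.2 hE

/-- The upper reading: a certificate for `−X` with value `q` gives `Re ⟨ψ, X ψ⟩ ≤ −q` (λ = −1 rows).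
[cite: WangEtAl2024, §3 eq. (obsopt)] -/
theorem re_expect_le (C : TorusSectorObsCertTT' L t t' U N M u (-X) q)
    (hE : (hubbardTorusTT' L t t' U).minEnergyOn (szSector N M) ≤ u)
    (ψ : Fock (Orb (FermionTorus 2 L))) (hψ1 : star ψ ⬝ᵥ ψ = 1)
    (hgs : IsGroundStateInSector (hubbardTorusTT' L t t' U) N M ψ) :
    (star ψ ⬝ᵥ X *ᵥ ψ).re ≤ -q := by
  have h := C.re_expect_ge hE ψ hψ1 hgs
  rw [neg_mulVec, dotProduct_neg, Complex.neg_re] at h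
  linarith

end TorusSectorObsCertTT'

end Torus

end Summit.HubbardSuperconductivity.HubbardLadder
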